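import Summits.KontsevichZagierPeriods.Statement

/-!
# KontsevichZagierPeriods / kernel form — the kernel conjecture implies the statement

Problem `KontsevichZagierPeriods`, topic `KernelForm`. The shared last step of every structural
route (NoriTransfer, Grothendieck, ExpConservative, AyoubSpecialisation): the kernel form
`ker (KZ.eval) = KZ.relations` (`Literature.NumberTheory.Transcendental.KZKernelConjecture`) implies the KZ-literal period
conjecture `KontsevichZagierPeriods = Literature.Periods.KZPeriodConjecture`, since
`r.value = r'.value` gives `KZ.eval ([r] - [r']) = 0` (`map_sub`, `KZ.eval_of`) and
`KZ.Equivalent r r'` is by definition `[r] - [r'] ∈ KZ.relations`; the rationality hypotheses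
on the endpoints are not used. Settles stmt-KontsevichZagierPeriods-0197.
[Kontsevich–Zagier 2001, §1.2; Huber–Müller-Stach 2017, §13.1 (kernel reformulation)]
-/

namespace Summit.KontsevichZagierPeriods.KernelForm

/-- Settles stmt-KontsevichZagierPeriods-0197: the kernel form of the period conjecture
(`ker eval = relations` on formal `ℤ`-combinations of integral representations) implies the
KZ-literal statement `KontsevichZagierPeriods`. [folklore] -/
theorem kontsevichZagierPeriods_of_kzKernelConjecture :
    Literature.NumberTheory.Transcendental.KZKernelConjecture → KontsevichZagierPeriods := by
  intro hK n m r r' _ _ hv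
  apply hK
  simp [Literature.NumberTheory.Transcendental.KZ.eval_of, hv]

end Summit.KontsevichZagierPeriods.KernelForm
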